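import Mathlib
import Literature.NumberTheory.ComplexMultiplication.SexticCMTypesB3
import HarnessLib

/-!
# Sextic CM fields, coordinate-free: primitivity and "no quadratic subfield" for an abstract faithful action

`SexticCMTypesB3.lean` works inside `𝔖₆ = Equiv.Perm (Fin 6)` with the fixed involution `cc = (0 3)(1 4)(2 5)`.
Here the same statements are derived for ANY finite group `G` of order `24` or `48` acting faithfully on ANY
six-element type `X` with a central involution `c ∈ G` moving every point — literally the shape of the Galois data
of a sextic CM field `K` with Galois closure `L`: `G = Gal(L/ℚ)` on `X = Hom(K, ℂ)` (faithful), `c` = complex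
conjugation (central, fixed-point-free on the embeddings of the CM field `K`), `x₀` = the base embedding,
`Stab_G(x₀) = Gal(L/K)`, a CM type `Φ ∋ x₀` = a finset `Φ ⊆ X` with `x ∈ Φ ↔ c • x ∉ Φ` (Dodson 1984, §1.1).

* `exists_equiv_cc` — NORMAL FORM: a fixed-point-free involution of a six-element type is conjugate to `cc` by a
  bijection `X ≃ Fin 6` sending a chosen point `x₀` to `0`;
* `toPerm6`, `toPerm6_injective`, `range_toPerm6_le_W` — the permutation image of `G` in `W(B₃) ≤ 𝔖₆`;
* **`isPrimitive_of_card_of_central_involution`** — every CM type `Φ ∋ x₀` is PRIMITIVE (`IsPrimitive G ↑Φ x₀`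
  of `ReflexType.lean`), and **`stabilizer_reflexLift_eq_of_central_involution`** — "`H' = H`": the stabiliser
  of the reflex lift `{g | g⁻¹ • x₀ ∈ Φ}` is `Stab_G(x₀)` (Shimura's criterion, Prop. 26);
* **`no_index_two_above_stabilizer`** — no index-two subgroup of `G` contains `Stab_G(x₀)` ("`K` contains no
  imaginary quadratic subfield"); `card_stabilizer` — for a transitive action `|Stab_G(x₀)| ∈ {4, 8}`.

## References

* B. Dodson, Trans. AMS 283 (1984) 1–32 [Dodson1984], §1.1 Imprimitivity Theorem (p. 3), §5.1.2–5.1.3 (p. 20).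
* G. Shimura, *Abelian varieties with complex multiplication and modular functions* (1998) [Shimura1998], §8.2
  Prop. 26.

## Provenance

Staged by the pub-hodgecm formalisation cell (DAG-node prover #01 lineage) under the LEAN-IN-TREE rule; it
supersedes the cell's standalone package file `HodgeCM/PerL34/GaloisB3Abstract.lean` (namespace
`HodgeCM.PerL34.GaloisB3` ↦ `Literature.NumberTheory.ComplexMultiplication.SexticB3`, same short names), with
the right-stabiliser statement of a ported 2001 file replaced by `IsPrimitive` / `reflexLift` of `ReflexType.lean`.

## Not here

The field-theoretic identifications (faithfulness of `Gal(L/ℚ)` on `Hom(K, ℂ)`, `|Gal(L/ℚ)| = [L:ℚ]`,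
`Gal(L/K) = Stab`), which are Mathlib Galois theory.
-/

set_option autoImplicit false

namespace Literature.NumberTheory.ComplexMultiplication

namespace SexticB3

open Equiv
open scoped Pointwise

/-! ### Normal form of a fixed-point-free involution on six points -/

section NormalForm

variable {X : Type*} [Fintype X] [DecidableEq X]

/-- Pigeonhole: a finset smaller than the type misses a point. [folklore] -/
private theorem exists_not_mem_of_card_lt (S : Finset X) (hS : S.card < Fintype.card X) : ∃ x, x ∉ S := by
  by_contra h
  push Not at h
  have : Finset.univ ⊆ S := fun x _ => h x
  have := Finset.card_le_card this
  rw [Finset.card_univ] at this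
  omega

/-- The coordinate vector `(x₀, x₁, x₂, σx₀, σx₁, σx₂)`. [folklore] -/
def nf6 (σ : Perm X) (x₀ x₁ x₂ : X) : Fin 6 → X := ![x₀, x₁, x₂, σ x₀, σ x₁, σ x₂]

/-- NORMAL FORM.  A fixed-point-free involution `σ` of a six-element type is conjugate to `cc` by a bijection
`X ≃ Fin 6` taking a prescribed point `x₀` to `0`. [folklore] -/
theorem exists_equiv_cc (hX : Fintype.card X = 6) (σ : Perm X) (hσ2 : ∀ x, σ (σ x) = x)
    (hfix : ∀ x, σ x ≠ x) (x₀ : X) :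
    ∃ e : X ≃ Fin 6, e x₀ = 0 ∧ ∀ x, e (σ x) = cc (e x) := by
  obtain ⟨x₁, hx₁⟩ := exists_not_mem_of_card_lt ({x₀, σ x₀} : Finset X)
    (lt_of_le_of_lt Finset.card_le_two (by omega))
  obtain ⟨x₂, hx₂⟩ := exists_not_mem_of_card_lt ({x₀, σ x₀, x₁, σ x₁} : Finset X)
    (lt_of_le_of_lt Finset.card_le_four (by omega))
  simp only [Finset.mem_insert, Finset.mem_singleton, not_or] at hx₁ hx₂
  obtain ⟨h10, h10'⟩ := hx₁
  obtain ⟨h20, h20', h21, h21'⟩ := hx₂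
  -- the fifteen pairwise inequalities
  have hσinj : ∀ {a b}, σ a = σ b → a = b := fun h => σ.injective h
  have n1 : σ x₁ ≠ x₀ := fun h => h10' (by rw [← h, hσ2])
  have n2 : σ x₂ ≠ x₀ := fun h => h20' (by rw [← h, hσ2])
  have n3 : σ x₂ ≠ x₁ := fun h => h21' (by rw [← h, hσ2])
  have n4 : σ x₁ ≠ σ x₀ := fun h => h10 (hσinj h)
  have n5 : σ x₂ ≠ σ x₀ := fun h => h20 (hσinj h)
  have n6 : σ x₂ ≠ σ x₁ := fun h => h21 (hσinj h)
  have f0 := hfix x₀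
  have f1 := hfix x₁
  have f2 := hfix x₂
  have ginj : Function.Injective (nf6 σ x₀ x₁ x₂) := by
    intro i j h
    fin_cases i <;> fin_cases j <;> simp [nf6] at h <;>
      first | rfl | exact absurd h (by assumption) | exact absurd h.symm (by assumption)
  have hg : ∀ i, σ (nf6 σ x₀ x₁ x₂ i) = nf6 σ x₀ x₁ x₂ (cc i) := by
    intro i
    rw [cc_apply]
    fin_cases i <;> first | exact hσ2 _ | rfl
  set g := nf6 σ x₀ x₁ x₂ with hgdef
  have gbij : Function.Bijective g :=
    (Fintype.bijective_iff_injective_and_card g).mpr ⟨ginj, by simp [hX]⟩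
  refine ⟨(Equiv.ofBijective g gbij).symm, ?_, ?_⟩
  · exact (Equiv.ofBijective g gbij).symm_apply_eq.mpr rfl
  · intro x
    obtain ⟨i, rfl⟩ := gbij.2 x
    rw [hg]
    simp [Equiv.ofBijective_symm_apply_apply]

end NormalForm

/-! ### Transport of an abstract faithful action to `Perm (Fin 6)` -/

section Transport

variable {G : Type*} [Group G] {X : Type*} [MulAction G X] (e : X ≃ Fin 6)

/-- The permutation image of `G` in `𝔖₆`, in the coordinates `e`. [folklore] -/
def toPerm6 : G →* Perm (Fin 6) := e.permCongrHom.toMonoidHom.comp (MulAction.toPermHom G X)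

/-- [folklore] -/
theorem toPerm6_apply (g : G) (i : Fin 6) : toPerm6 e g i = e (g • e.symm i) := rfl

/-- A faithful action gives an injective permutation image. [folklore] -/
theorem toPerm6_injective [FaithfulSMul G X] : Function.Injective (toPerm6 (G := G) e) :=
  e.permCongrHom.injective.comp MulAction.toPerm_injective

variable {e}

/-- A `c` acting through `cc` (in the coordinates `e`) maps to `cc`. [folklore] -/
theorem toPerm6_eq_cc {c : G} (hce : ∀ x, e (c • x) = cc (e x)) : toPerm6 e c = cc := by
  ext i
  rw [toPerm6_apply, hce, Equiv.apply_symm_apply]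

/-- If moreover `c` is central, the permutation image lies in `W = C_{𝔖₆}(cc)`.
[cite: Dodson1984, §1.1 Imprimitivity Theorem] -/
theorem range_toPerm6_le_W {c : G} (hcen : ∀ g : G, c * g = g * c) (hce : ∀ x, e (c • x) = cc (e x)) :
    (toPerm6 (G := G) e).range ≤ W := by
  rintro _ ⟨g, rfl⟩
  rw [mem_W, ← toPerm6_eq_cc hce, ← map_mul, ← map_mul, hcen]

end Transport

/-! ### The abstract statements -/

section Abstract

variable {G : Type*} [Group G] {X : Type*} [Fintype X] [DecidableEq X] [MulAction G X] [FaithfulSMul G X]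

/-- **Every CM type of a sextic CM field with `|Gal(L/ℚ)| ∈ {24, 48}` is primitive, coordinate-free.**  Let `G`
(of order `24` or `48`) act faithfully on a six-element type `X`; let `c ∈ G` be central with `c² = 1` moving every
point; let `Φ ⊆ X` be a CM type (`x ∈ Φ ↔ c • x ∉ Φ`) containing `x₀`.  Then `(Φ, x₀)` is primitive in Shimura's
sense (`IsPrimitive`). [cite: Shimura1998, §8.2 Prop. 26] -/
theorem isPrimitive_of_card_of_central_involution (hX : Fintype.card X = 6)
    (hcard : Nat.card G = 24 ∨ Nat.card G = 48) (c : G) (hcen : ∀ g : G, c * g = g * c) (hc2 : c * c = 1)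
    (hfix : ∀ x : X, c • x ≠ x) (Φ : Finset X) (hΦ : ∀ x, x ∈ Φ ↔ c • x ∉ Φ) (x₀ : X) (h0 : x₀ ∈ Φ) :
    IsPrimitive G (↑Φ : Set X) x₀ := by
  -- normal form for the involution `c`
  obtain ⟨e, he0, hce⟩ := exists_equiv_cc hX (MulAction.toPerm c)
    (fun x => by simp [MulAction.toPerm_apply, smul_smul, hc2]) (fun x => hfix x) x₀
  replace hce : ∀ x, e (c • x) = cc (e x) := fun x => by simpa [MulAction.toPerm_apply] using hce x
  -- the permutation image
  set f : G →* Perm (Fin 6) := toPerm6 e with hf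
  have hfinj : Function.Injective f := toPerm6_injective e
  have hW : f.range ≤ W := range_toPerm6_le_W hcen hce
  have hcc : cc ∈ f.range := ⟨c, toPerm6_eq_cc hce⟩
  have hcard' : Nat.card f.range = 24 ∨ Nat.card f.range = 48 := by
    rwa [← Nat.card_congr (MonoidHom.ofInjective hfinj).toEquiv]
  obtain ⟨-, hf1, hf2⟩ := flips_mem f.range hW hcc hcard'
  -- the transported CM type
  set Φ6 : Finset (Fin 6) := Φ.map e.toEmbedding with hΦ6
  have hmem : ∀ x, e x ∈ Φ6 ↔ x ∈ Φ := fun x => by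
    rw [hΦ6, Finset.mem_map_equiv, Equiv.symm_apply_apply]
  have hΦ6cm : IsCMType Φ6 := by
    intro a
    obtain ⟨x, rfl⟩ := e.surjective a
    rw [hmem, ← hce, hmem]
    exact hΦ x
  have h06 : (0 : Fin 6) ∈ Φ6 := by rw [← he0, hmem]; exact h0
  have hf0Φ : ∀ g : G, (f g) 0 ∈ Φ6 ↔ g • x₀ ∈ Φ := fun g => by
    rw [hf, toPerm6_apply, ← he0, Equiv.symm_apply_apply, hmem]
  -- primitivity from the finite computation `rstab_iff_fix` in `f.range`
  intro H _ hH u hu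
  have key : ∀ x ∈ f.range, (x * f u) 0 ∈ Φ6 ↔ x 0 ∈ Φ6 := by
    rintro _ ⟨g, rfl⟩
    rw [← map_mul, hf0Φ, hf0Φ]
    have h := hH u hu g
    simpa only [mem_typeLift, Finset.mem_coe, mul_smul] using h
  have hfix0 : (f u) 0 = 0 := (rstab_iff_fix hf1 hf2 hΦ6cm h06 (f u)).1 key
  rw [MulAction.mem_stabilizer_iff]
  rw [hf, toPerm6_apply, ← he0, Equiv.symm_apply_apply] at hfix0
  exact e.injective hfix0

/-- Consequently "`H' = H`", coordinate-free: the stabiliser in `G` of the reflex lift `{g | g⁻¹ • x₀ ∈ Φ}` is the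
stabiliser of `x₀` (so the reflex field of the reflex type of `(K, Φ)` is `K`). [cite: Shimura1998, §8.2 Prop. 26] -/
theorem stabilizer_reflexLift_eq_of_central_involution (hX : Fintype.card X = 6)
    (hcard : Nat.card G = 24 ∨ Nat.card G = 48) (c : G) (hcen : ∀ g : G, c * g = g * c) (hc2 : c * c = 1)
    (hfix : ∀ x : X, c • x ≠ x) (Φ : Finset X) (hΦ : ∀ x, x ∈ Φ ↔ c • x ∉ Φ) (x₀ : X) (h0 : x₀ ∈ Φ) :
    MulAction.stabilizer G (reflexLift (↑Φ : Set X) x₀ : Set G) = MulAction.stabilizer G x₀ :=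
  (isPrimitive_of_card_of_central_involution hX hcard c hcen hc2 hfix Φ hΦ x₀ h0).stabilizer_reflexLift_eq

/-- **"`K` contains no imaginary quadratic field"**, coordinate-free: under the same hypotheses, no subgroup `M` of
index two in `G` contains the stabiliser of `x₀` (Galois correspondence: such an `M` would be `Gal(L/E)` for a
quadratic field `E ⊆ K`). [folklore] -/
theorem no_index_two_above_stabilizer (hX : Fintype.card X = 6)
    (hcard : Nat.card G = 24 ∨ Nat.card G = 48) (c : G) (hcen : ∀ g : G, c * g = g * c) (hc2 : c * c = 1)
    (hfix : ∀ x : X, c • x ≠ x) (x₀ : X) (M : Subgroup G) (hM : MulAction.stabilizer G x₀ ≤ M)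
    (hidx : Nat.card M * 2 = Nat.card G) : False := by
  classical
  obtain ⟨e, he0, hce⟩ := exists_equiv_cc hX (MulAction.toPerm c)
    (fun x => by simp [MulAction.toPerm_apply, smul_smul, hc2]) (fun x => hfix x) x₀
  replace hce : ∀ x, e (c • x) = cc (e x) := fun x => by simpa [MulAction.toPerm_apply] using hce x
  set f : G →* Perm (Fin 6) := toPerm6 e with hf
  have hfinj : Function.Injective f := toPerm6_injective e
  have hW : f.range ≤ W := range_toPerm6_le_W hcen hce
  have hcc : cc ∈ f.range := ⟨c, toPerm6_eq_cc hce⟩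
  have hGcard : Nat.card f.range = Nat.card G := (Nat.card_congr (MonoidHom.ofInjective hfinj).toEquiv).symm
  have hcard' : Nat.card f.range = 24 ∨ Nat.card f.range = 48 := by rwa [hGcard]
  have hMcard : Nat.card (M.map f) = Nat.card M := Nat.card_congr (M.equivMapOfInjective f hfinj).toEquiv.symm
  refine no_index_two_over_stab f.range hW hcc hcard' (M.map f) ?_ ?_ ?_
  · exact Subgroup.map_le_range f M
  · rintro _ ⟨g, rfl⟩ hg0
    refine ⟨g, hM ?_, rfl⟩
    rw [MulAction.mem_stabilizer_iff]
    have : e (g • e.symm 0) = 0 := by simpa [hf, toPerm6_apply] using hg0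
    rw [← he0, Equiv.symm_apply_apply] at this
    exact e.injective this
  · rw [hMcard, hGcard]; exact hidx

omit [DecidableEq X] [FaithfulSMul G X] in
/-- For a TRANSITIVE action (as `Gal(L/ℚ)` on `Hom(K,ℂ)` is) with `|G| ∈ {24, 48}`, the stabiliser has order
`|G| / 6 ∈ {4, 8}`. [folklore] -/
theorem card_stabilizer [MulAction.IsPretransitive G X] (hX : Fintype.card X = 6)
    (hcard : Nat.card G = 24 ∨ Nat.card G = 48) (x₀ : X) :
    Nat.card (MulAction.stabilizer G x₀) = 4 ∨ Nat.card (MulAction.stabilizer G x₀) = 8 := by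
  have h := (MulAction.stabilizer G x₀).card_mul_index
  rw [MulAction.index_stabilizer_of_transitive, Nat.card_eq_fintype_card (α := X), hX] at h
  omega

end Abstract

end SexticB3

end Literature.NumberTheory.ComplexMultiplication
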